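import Summits.CriticalPhenomena.Ising3D.TaylorTableExpr
import Literature.MathematicalPhysics.QuantumFieldTheory.ConformalBootstrap3D.PointCertificate
import Mathlib.Tactic.Linarith
import Mathlib.Tactic.Positivity
import Mathlib.Tactic.Ring
import HarnessLib

/-!
# The TABLE layer of a derivative certificate, III: an even head cell from kd-tree checks
(cell `pub-ising3x`, seat boot-1 gen 6; gate (g2) — the per-cell hypothesis `hhead` of
`evenCellField_of_cover` for the concrete functional `taylorCrossing ½ ½ S w`, in POLYBOX form)

HONEST FRAMING: lottery ticket; floor = tightest certified 3D Ising CFT bounds; no exact-solution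
claim without a proof.

On an even head cell (spin `ℓ`, `Δ ∈ [lo, hi]`, head list `F = [(n₀,j₀), …]`) the head form
`Σ_{q∈F} (A_{n,j}(Δ,ℓ)/λ_ℓ) · evenForm (𝒫_{Δ+n,j}) (a,b)` of `α = taylorCrossing ½ ½ S w` is, by the closed
form `sum_smul_taylorCoeffAt_crossF_zMono_half`, the quadratic form
`a² (½)^{2Δσ}(½)^Δ X̃ + b² (½)^{2Δε}(½)^Δ Ỹ + ab (½)^{Δσ+Δε}(½)^Δ Z̃` with
`X̃ = Σ_i A_i 2^{-nᵢ} X̂(Δ+nᵢ, jᵢ; Δσ)`, `Ỹ = Σ_i A_i 2^{-nᵢ} Ŷ(Δ+nᵢ, jᵢ; Δε)`,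
`Z̃ = Σ_i A_i 2^{-nᵢ} Ẑ(Δ+nᵢ, jᵢ; s̄)` (`A_i = A_{nᵢ,jᵢ}(Δ,ℓ)/λ_ℓ`, q-sums `X̂, Ŷ, Ẑ` of
`TaylorRegionQPoly`). The transcendental prefactors cancel in the PSD test (`(½)^{2(Δσ+Δε)} = (½)^{2Δσ}(½)^{2Δε}`),
so the cell obligation follows from the THREE POLYNOMIAL CLAIMS `X̃ ≥ 0`, `Ỹ ≥ 0`, `4X̃Ỹ - Z̃² ≥ 0` in the
variables `x₀ = Δσ, x₁ = Δε, x₂ = Δ, x₃₊ᵢ = A_i`, where the block coefficients `A_i` are ENCLOSURE VARIABLES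
ranging over rational intervals `[Alo_i, Ahi_i] ∋ A_{nᵢ,jᵢ}(Δ,ℓ)/λ_ℓ` for all `Δ` in the cell (hypothesis
`henc`, discharged by the coefficient tables of the Literature layer — `HRCoeffTM` / `HRCoeffCellBounds` — or
by a reader's exact interval recursion). `evenHead_nonneg_of_kdCheck`: enclosures + three accepted kd-tree
certificates ⇒ the head form is PSD at every point of `[σlo,σhi] × [εlo,εhi] × [lo,hi]`.
Sources: Kos–Poland–Simmons-Duffin 2014 §3.3 eq. (3.16); Hogervorst–Rychkov 2013 §3 eq. (3.9). Elementary.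
-/

namespace Summit.CriticalPhenomena.Ising3D

open Finset Set
open Literature.MathematicalPhysics.QuantumFieldTheory.ConformalBootstrap3D
open Literature.Analysis.ValidatedNumerics

/-! ### Head sums with one enclosure variable per head term -/

/-- `Σ_i x_{k+i} · term(qᵢ)` over the list `qs = [q₀, q₁, …]`, the `i`-th term weighted by the variable
`k + i`. [folklore] -/
def headSumExpr (term : ℕ × ℕ → ArithExpr) : ℕ → List (ℕ × ℕ) → ArithExpr
  | _, [] => .const 0
  | k, q :: qs => .add (.mul (.var k) (term q)) (headSumExpr term (k + 1) qs)

/-- Evaluation of `headSumExpr`: if the variables `k, k+1, …` hold the values `v q₀, v q₁, …` then the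
expression evaluates to `Σ_{q ∈ qs} v q · eval (term q)` (as a list sum). [folklore] -/
theorem eval_headSumExpr (x : ℕ → ℝ) (term : ℕ × ℕ → ArithExpr) (v : ℕ × ℕ → ℝ) :
    ∀ (k : ℕ) (qs : List (ℕ × ℕ)), (∀ (i : ℕ) (q : ℕ × ℕ), qs[i]? = some q → x (k + i) = v q) →
      (headSumExpr term k qs).eval x = (qs.map fun q => v q * (term q).eval x).sum
  | _, [], _ => by simp [headSumExpr]
  | k, q :: qs, hx => by
    rw [headSumExpr, ArithExpr.eval_add, ArithExpr.eval_mul, ArithExpr.eval_var, List.map_cons,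
      List.sum_cons]
    have h0 : x k = v q := by simpa using hx 0 q rfl
    rw [h0, eval_headSumExpr x term v (k + 1) qs fun i q' hq' => by
      rw [show k + 1 + i = k + (i + 1) by ring]; exact hx (i + 1) q' (by simpa using hq')]

/-- The reduced even head entry `X̃` (component 1, exponent `Δσ`) as an expression (variables
`x₀ = Δσ, x₁ = Δε, x₂ = Δ`, `x₃₊ᵢ = A_i`). [folklore] -/
def evenHeadXExpr (c : Fin 5 → ℕ × ℕ → ℚ) (L F : List (ℕ × ℕ)) : ArithExpr :=
  headSumExpr (fun q => .mul (.const (1 / 2 ^ q.1))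
    (qSumExpr (c 0) L (.var 0) (-1) (.add (.var 2) (.const q.1)) q.2)) 3 F

/-- The reduced even head entry `Ỹ` (component 2, exponent `Δε`). [folklore] -/
def evenHeadYExpr (c : Fin 5 → ℕ × ℕ → ℚ) (L F : List (ℕ × ℕ)) : ArithExpr :=
  headSumExpr (fun q => .mul (.const (1 / 2 ^ q.1))
    (qSumExpr (c 1) L (.var 1) (-1) (.add (.var 2) (.const q.1)) q.2)) 3 F

/-- The reduced even head entry `Z̃ = Z̃₋ + Z̃₊` (components 4, 5, exponent `s̄ = (Δσ+Δε)/2`). [folklore] -/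
def evenHeadZExpr (c : Fin 5 → ℕ × ℕ → ℚ) (L F : List (ℕ × ℕ)) : ArithExpr :=
  headSumExpr (fun q => .mul (.const (1 / 2 ^ q.1))
    (.add (qSumExpr (c 3) L (.mul (.add (.var 0) (.var 1)) (.const (1 / 2))) (-1) (.add (.var 2) (.const q.1)) q.2)
      (qSumExpr (c 4) L (.mul (.add (.var 0) (.var 1)) (.const (1 / 2))) 1 (.add (.var 2) (.const q.1)) q.2))) 3 F

/-- The determinant claim `4 X̃ Ỹ - Z̃²` as an expression. [folklore] -/
def evenHeadDetExpr (c : Fin 5 → ℕ × ℕ → ℚ) (L F : List (ℕ × ℕ)) : ArithExpr :=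
  .sub (.mul (.const 4) (.mul (evenHeadXExpr c L F) (evenHeadYExpr c L F)))
    (.mul (evenHeadZExpr c L F) (evenHeadZExpr c L F))

/-- The point `(Δσ, Δε, Δ, A₀, A₁, …)` fed to the head expressions, `A_i = A_{nᵢ,jᵢ}(Δ,ℓ)/λ_ℓ`. [folklore] -/
noncomputable def evenHeadPoint (ℓ : ℕ) (F : List (ℕ × ℕ)) (Δσ Δε Δ : ℝ) : ℕ → ℝ
  | 0 => Δσ
  | 1 => Δε
  | 2 => Δ
  | n + 3 => (F.map fun q => hrCoeff Δ ℓ q.1 q.2 / legendreLam ℓ).getD n 0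

/-- The head variables hold the coefficient values. [folklore] -/
theorem evenHeadPoint_var (ℓ : ℕ) (F : List (ℕ × ℕ)) (Δσ Δε Δ : ℝ) (i : ℕ) (q : ℕ × ℕ) (h : F[i]? = some q) :
    evenHeadPoint ℓ F Δσ Δε Δ (3 + i) = hrCoeff Δ ℓ q.1 q.2 / legendreLam ℓ := by
  rw [show 3 + i = i + 3 by ring]
  simp only [evenHeadPoint]
  rw [List.getD_eq_getElem?_getD, List.getElem?_map, h]
  simp

/-- The box `[σlo,σhi] × [εlo,εhi] × [lo,hi] × Π_i [Alo_i, Ahi_i]`. [folklore] -/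
def evenHeadBox (σlo σhi εlo εhi lo hi : ℚ) (A : List (ℚ × ℚ)) : Box :=
  (σlo, σhi) :: (εlo, εhi) :: (lo, hi) :: A

/-- **Membership of the head point in the head box** from the coordinate bounds and the enclosures
(`A` and `F` of the same length; entry `i` of `A` encloses the coefficient of entry `i` of `F`). [folklore] -/
theorem evenHeadPoint_mem {ℓ : ℕ} {F : List (ℕ × ℕ)} {σlo σhi εlo εhi lo hi : ℚ} {A : List (ℚ × ℚ)}
    (hA : A.length = F.length) {Δσ Δε Δ : ℝ}
    (hσ : (σlo : ℝ) ≤ Δσ ∧ Δσ ≤ σhi) (hε : (εlo : ℝ) ≤ Δε ∧ Δε ≤ εhi) (hΔ : (lo : ℝ) ≤ Δ ∧ Δ ≤ hi)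
    (henc : ∀ (i : ℕ) (q : ℕ × ℕ) (I : ℚ × ℚ), F[i]? = some q → A[i]? = some I →
      (I.1 : ℝ) ≤ hrCoeff Δ ℓ q.1 q.2 / legendreLam ℓ ∧ hrCoeff Δ ℓ q.1 q.2 / legendreLam ℓ ≤ (I.2 : ℝ)) :
    (evenHeadBox σlo σhi εlo εhi lo hi A).mem (evenHeadPoint ℓ F Δσ Δε Δ) := by
  intro i
  match i with
  | 0 => exact hσ
  | 1 => exact hε
  | 2 => exact hΔ
  | n + 3 =>
    simp only [evenHeadBox, Box.ivl, List.getD_cons_succ]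
    by_cases hn : n < F.length
    · have hnA : n < A.length := hA ▸ hn
      obtain ⟨q, hq⟩ : ∃ q, F[n]? = some q := ⟨F[n], List.getElem?_eq_getElem hn⟩
      have hI : A[n]? = some A[n] := List.getElem?_eq_getElem hnA
      rw [List.getD_eq_getElem?_getD, hI, Option.getD_some, show n + 3 = 3 + n by ring,
        evenHeadPoint_var ℓ F Δσ Δε Δ n q hq]
      exact henc n q _ hq hI
    · rw [List.getD_eq_default _ _ (by rw [hA]; omega)]
      simp only [evenHeadPoint]
      rw [List.getD_eq_default _ _ (by simpa using not_lt.mp hn)]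
      simp

/-! ### The head form in terms of `X̃, Ỹ, Z̃` -/

/-- The three reduced head entries as real numbers (list sums over `F`). [folklore] -/
noncomputable def evenHeadX (w : ℕ × ℕ → ℝ) (S : Finset (ℕ × ℕ)) (ℓ : ℕ) (F : List (ℕ × ℕ)) (s Δ : ℝ)
    (σ : ℝ) : ℝ :=
  (F.map fun q => hrCoeff Δ ℓ q.1 q.2 / legendreLam ℓ *
    ((1 / 2 : ℝ) ^ q.1 * qSum w S s σ (Δ + (q.1 : ℝ)) q.2)).sum

/-- **The head form is a prefactor-weighted quadratic form in `X̃, Ỹ, Z̃`.** For `Δ ≥ ℓ` and head terms in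
the range `j ≤ ℓ + n`:
`Σ_{q∈F} (A_q/λ) evenForm(𝒫_{Δ+n,j})(a,b) = a² P₁ X̃ + b² P₂ Ỹ + ab P₃ (Z̃₋ + Z̃₊)` with
`P₁ = (½)^{2Δσ}(½)^Δ`, `P₂ = (½)^{2Δε}(½)^Δ`, `P₃ = (½)^{Δσ+Δε}(½)^Δ`. [cite: KosPolandSimmonsduffin2014, §3.3 eq. (3.16)] -/
theorem evenHead_sum_eq (S : Finset (ℕ × ℕ)) (w : Fin 5 → ℕ × ℕ → ℝ) (ℓ : ℕ) (F : List (ℕ × ℕ))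
    (hFj : ∀ q ∈ F, q.2 ≤ ℓ + q.1) {Δ : ℝ} (hℓΔ : (ℓ : ℝ) ≤ Δ) (Δσ Δε a b : ℝ) :
    (F.map fun q => hrCoeff Δ ℓ q.1 q.2 / legendreLam ℓ *
        (taylorCrossing (1 / 2) (1 / 2) S w).evenForm Δσ Δε (zMono (Δ + (q.1 : ℝ)) q.2) a b).sum =
      a ^ 2 * ((1 / 2 : ℝ) ^ (2 * Δσ) * (1 / 2 : ℝ) ^ Δ) * evenHeadX (w 0) S ℓ F Δσ Δ (-1) +
        b ^ 2 * ((1 / 2 : ℝ) ^ (2 * Δε) * (1 / 2 : ℝ) ^ Δ) * evenHeadX (w 1) S ℓ F Δε Δ (-1) +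
        a * b * ((1 / 2 : ℝ) ^ (2 * ((Δσ + Δε) / 2)) * (1 / 2 : ℝ) ^ Δ) *
          (evenHeadX (w 3) S ℓ F ((Δσ + Δε) / 2) Δ (-1) + evenHeadX (w 4) S ℓ F ((Δσ + Δε) / 2) Δ 1) := by
  induction F with
  | nil => simp [evenHeadX]
  | cons q qs ih =>
    have hq : (q.2 : ℝ) ≤ Δ + (q.1 : ℝ) := by
      have h1 : q.2 ≤ ℓ + q.1 := hFj q (by simp)
      have : (q.2 : ℝ) ≤ (ℓ : ℝ) + (q.1 : ℝ) := by exact_mod_cast h1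
      linarith
    have ih' := ih fun q' hq' => hFj q' (List.mem_cons_of_mem _ hq')
    simp only [List.map_cons, List.sum_cons, evenHeadX] at ih' ⊢
    rw [ih']
    have h0 : (0 : ℝ) < 1 / 2 := by norm_num
    have hsplit : (1 / 2 : ℝ) ^ (Δ + (q.1 : ℝ)) = (1 / 2 : ℝ) ^ Δ * (1 / 2 : ℝ) ^ q.1 := by
      rw [Real.rpow_add h0, Real.rpow_natCast]
    unfold CrossingFunctional.evenForm
    have e1 : (taylorCrossing (1 / 2) (1 / 2) S w).α₁ (crossF Δσ (-1) (zMono (Δ + (q.1 : ℝ)) q.2)) =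
        (1 / 2 : ℝ) ^ (2 * Δσ) * (1 / 2 : ℝ) ^ (Δ + (q.1 : ℝ)) * qSum (w 0) S Δσ (-1) (Δ + (q.1 : ℝ)) q.2 :=
      sum_smul_taylorCoeffAt_crossF_zMono_half _ _ _ _ _ _ hq
    have e2 : (taylorCrossing (1 / 2) (1 / 2) S w).α₂ (crossF Δε (-1) (zMono (Δ + (q.1 : ℝ)) q.2)) =
        (1 / 2 : ℝ) ^ (2 * Δε) * (1 / 2 : ℝ) ^ (Δ + (q.1 : ℝ)) * qSum (w 1) S Δε (-1) (Δ + (q.1 : ℝ)) q.2 :=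
      sum_smul_taylorCoeffAt_crossF_zMono_half _ _ _ _ _ _ hq
    have e4 : (taylorCrossing (1 / 2) (1 / 2) S w).α₄ (crossF ((Δσ + Δε) / 2) (-1) (zMono (Δ + (q.1 : ℝ)) q.2)) =
        (1 / 2 : ℝ) ^ (2 * ((Δσ + Δε) / 2)) * (1 / 2 : ℝ) ^ (Δ + (q.1 : ℝ)) *
          qSum (w 3) S ((Δσ + Δε) / 2) (-1) (Δ + (q.1 : ℝ)) q.2 :=
      sum_smul_taylorCoeffAt_crossF_zMono_half _ _ _ _ _ _ hq
    have e5 : (taylorCrossing (1 / 2) (1 / 2) S w).α₅ (crossF ((Δσ + Δε) / 2) 1 (zMono (Δ + (q.1 : ℝ)) q.2)) =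
        (1 / 2 : ℝ) ^ (2 * ((Δσ + Δε) / 2)) * (1 / 2 : ℝ) ^ (Δ + (q.1 : ℝ)) *
          qSum (w 4) S ((Δσ + Δε) / 2) 1 (Δ + (q.1 : ℝ)) q.2 :=
      sum_smul_taylorCoeffAt_crossF_zMono_half _ _ _ _ _ _ hq
    rw [e1, e2, e4, e5, hsplit]
    ring

/-- **PSD from the three reduced claims** (prefactor cancellation, as in `taylorEvenRegion_half_of_qRegion`).
[cite: KosPolandSimmonsduffin2014, §3.3 eq. (3.16)] -/
theorem evenHead_nonneg_of_reduced (S : Finset (ℕ × ℕ)) (w : Fin 5 → ℕ × ℕ → ℝ) (ℓ : ℕ) (F : List (ℕ × ℕ))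
    (hF : F.Nodup) (hFj : ∀ q ∈ F, q.2 ≤ ℓ + q.1) {Δ : ℝ} (hℓΔ : (ℓ : ℝ) ≤ Δ) (Δσ Δε : ℝ)
    (hX : 0 ≤ evenHeadX (w 0) S ℓ F Δσ Δ (-1)) (hY : 0 ≤ evenHeadX (w 1) S ℓ F Δε Δ (-1))
    (hD : (evenHeadX (w 3) S ℓ F ((Δσ + Δε) / 2) Δ (-1) + evenHeadX (w 4) S ℓ F ((Δσ + Δε) / 2) Δ 1) ^ 2 ≤
      4 * evenHeadX (w 0) S ℓ F Δσ Δ (-1) * evenHeadX (w 1) S ℓ F Δε Δ (-1)) (a b : ℝ) :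
    0 ≤ ∑ q ∈ F.toFinset, hrCoeff Δ ℓ q.1 q.2 / legendreLam ℓ *
      (taylorCrossing (1 / 2) (1 / 2) S w).evenForm Δσ Δε (zMono (Δ + (q.1 : ℝ)) q.2) a b := by
  rw [List.sum_toFinset _ hF, evenHead_sum_eq S w ℓ F hFj hℓΔ]
  have h0 : (0 : ℝ) < 1 / 2 := by norm_num
  set P₁ := (1 / 2 : ℝ) ^ (2 * Δσ) * (1 / 2 : ℝ) ^ Δ with hP₁
  set P₂ := (1 / 2 : ℝ) ^ (2 * Δε) * (1 / 2 : ℝ) ^ Δ with hP₂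
  set P₃ := (1 / 2 : ℝ) ^ (2 * ((Δσ + Δε) / 2)) * (1 / 2 : ℝ) ^ Δ with hP₃
  have hP₁0 : 0 < P₁ := mul_pos (Real.rpow_pos_of_pos h0 _) (Real.rpow_pos_of_pos h0 _)
  have hP₂0 : 0 < P₂ := mul_pos (Real.rpow_pos_of_pos h0 _) (Real.rpow_pos_of_pos h0 _)
  have hP : P₃ * P₃ = P₁ * P₂ := by
    simp only [hP₁, hP₂, hP₃]
    rw [← Real.rpow_add h0, ← Real.rpow_add h0, ← Real.rpow_add h0, ← Real.rpow_add h0,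
      ← Real.rpow_add h0]
    congr 1
    ring
  set X := evenHeadX (w 0) S ℓ F Δσ Δ (-1)
  set Y := evenHeadX (w 1) S ℓ F Δε Δ (-1)
  set Z := evenHeadX (w 3) S ℓ F ((Δσ + Δε) / 2) Δ (-1) + evenHeadX (w 4) S ℓ F ((Δσ + Δε) / 2) Δ 1
  have key : a ^ 2 * P₁ * X + b ^ 2 * P₂ * Y + a * b * P₃ * Z =
      a ^ 2 * (P₁ * X) + b ^ 2 * (P₂ * Y) + a * b * (P₃ * Z) := by ring
  rw [key]
  refine quadForm_nonneg_of_det (by positivity) (by positivity) ?_ a b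
  have h3 : (P₃ * Z) ^ 2 = P₁ * P₂ * Z ^ 2 := by rw [← hP]; ring
  rw [h3, show 4 * (P₁ * X) * (P₂ * Y) = P₁ * P₂ * (4 * X * Y) by ring]
  exact mul_le_mul_of_nonneg_left hD (mul_pos hP₁0 hP₂0).le

/-! ### Evaluation of the head expressions and the table theorem -/

/-- Evaluation of the `X̃`-type head expression at the head point. [folklore] -/
theorem eval_evenHead_generic (c : Fin 5 → ℕ × ℕ → ℚ) {L : List (ℕ × ℕ)} (hL : L.Nodup) (ℓ : ℕ)
    (F : List (ℕ × ℕ)) (Δσ Δε Δ : ℝ) (k : Fin 5) (es : ArithExpr) (σ : ℚ) :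
    (headSumExpr (fun q => .mul (.const (1 / 2 ^ q.1))
        (qSumExpr (c k) L es σ (.add (.var 2) (.const q.1)) q.2)) 3 F).eval (evenHeadPoint ℓ F Δσ Δε Δ) =
      evenHeadX (fun ab => (c k ab : ℝ)) L.toFinset ℓ F (es.eval (evenHeadPoint ℓ F Δσ Δε Δ)) Δ σ := by
  rw [eval_headSumExpr _ _ (fun q => hrCoeff Δ ℓ q.1 q.2 / legendreLam ℓ) 3 F
    (fun i q hq => evenHeadPoint_var ℓ F Δσ Δε Δ i q hq), evenHeadX]
  congr 1
  refine List.map_congr_left fun q _ => ?_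
  simp only [ArithExpr.eval_mul, ArithExpr.eval_const, ArithExpr.eval_add, ArithExpr.eval_var,
    eval_qSumExpr _ _ hL]
  simp only [evenHeadPoint]
  push_cast
  simp only [one_div, inv_pow, mul_left_comm]

/-- **TABLE THEOREM, even head cell.** For rational weights `c` on the index list `L`, an even head cell
(spin `ℓ`, `Δ`-interval `[lo, hi]` with `ℓ ≤ lo`, head list `F` in the descendant range `j ≤ ℓ + n`),
enclosure intervals `A` (entry `i` encloses `A_{nᵢ,jᵢ}(Δ,ℓ)/λ_ℓ` on the whole cell), and accepted kd-tree
certificates of `-X̃ ≤ 0`, `-Ỹ ≤ 0`, `-(4X̃Ỹ - Z̃²) ≤ 0` on the head box: the head form is PSD at every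
`(Δσ, Δε) ∈ [σlo,σhi] × [εlo,εhi]` and every `Δ ∈ [lo, hi]`. [cite: KosPolandSimmonsduffin2014, §3.3 eq. (3.16)] -/
theorem evenHead_nonneg_of_kdCheck (c : Fin 5 → ℕ × ℕ → ℚ) {L : List (ℕ × ℕ)} (hL : L.Nodup) (ℓ : ℕ)
    {F : List (ℕ × ℕ)} (hF : F.Nodup) (hFj : ∀ q ∈ F, q.2 ≤ ℓ + q.1)
    {σlo σhi εlo εhi lo hi : ℚ} (hℓlo : (ℓ : ℚ) ≤ lo) {A : List (ℚ × ℚ)} (hA : A.length = F.length)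
    (henc : ∀ Δ : ℝ, (lo : ℝ) ≤ Δ → Δ ≤ hi → ∀ (i : ℕ) (q : ℕ × ℕ) (I : ℚ × ℚ), F[i]? = some q →
      A[i]? = some I →
      (I.1 : ℝ) ≤ hrCoeff Δ ℓ q.1 q.2 / legendreLam ℓ ∧ hrCoeff Δ ℓ q.1 q.2 / legendreLam ℓ ≤ (I.2 : ℝ))
    {tX tY tD : KdCert ℕ}
    (hX : tX.check (exprLeOn (.neg (evenHeadXExpr c L F)) 0) (evenHeadBox σlo σhi εlo εhi lo hi A) = true)
    (hY : tY.check (exprLeOn (.neg (evenHeadYExpr c L F)) 0) (evenHeadBox σlo σhi εlo εhi lo hi A) = true)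
    (hD : tD.check (exprLeOn (.neg (evenHeadDetExpr c L F)) 0) (evenHeadBox σlo σhi εlo εhi lo hi A) = true) :
    ∀ p ∈ Icc (σlo : ℝ) σhi ×ˢ Icc (εlo : ℝ) εhi, ∀ Δ : ℝ, (lo : ℝ) ≤ Δ → Δ ≤ hi → ∀ a b : ℝ,
      0 ≤ ∑ q ∈ F.toFinset, hrCoeff Δ ℓ q.1 q.2 / legendreLam ℓ *
        (taylorCrossing (1 / 2) (1 / 2) L.toFinset (fun i ab => (c i ab : ℝ))).evenForm p.1 p.2
          (zMono (Δ + (q.1 : ℝ)) q.2) a b := by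
  intro p hp Δ hlo hhi a b
  obtain ⟨hσ, hε⟩ := hp
  have hℓΔ : (ℓ : ℝ) ≤ Δ := by
    have : ((ℓ : ℚ) : ℝ) ≤ (lo : ℝ) := by exact_mod_cast hℓlo
    push_cast at this
    linarith
  have hmem := evenHeadPoint_mem (ℓ := ℓ) hA hσ hε ⟨hlo, hhi⟩ (henc Δ hlo hhi)
  have h1 := nonneg_of_kdCheck_neg hX _ hmem
  have h2 := nonneg_of_kdCheck_neg hY _ hmem
  have h3 := nonneg_of_kdCheck_neg hD _ hmem
  rw [evenHeadXExpr, eval_evenHead_generic c hL ℓ F p.1 p.2 Δ 0 _ _] at h1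
  rw [evenHeadYExpr, eval_evenHead_generic c hL ℓ F p.1 p.2 Δ 1 _ _] at h2
  simp only [evenHeadDetExpr, evenHeadXExpr, evenHeadYExpr, evenHeadZExpr, ArithExpr.eval_sub,
    ArithExpr.eval_mul, ArithExpr.eval_const] at h3
  rw [eval_evenHead_generic c hL ℓ F p.1 p.2 Δ 0 _ _, eval_evenHead_generic c hL ℓ F p.1 p.2 Δ 1 _ _,
    eval_headSumExpr _ _ (fun q => hrCoeff Δ ℓ q.1 q.2 / legendreLam ℓ) 3 F
      (fun i q hq => evenHeadPoint_var ℓ F p.1 p.2 Δ i q hq)] at h3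
  simp only [ArithExpr.eval_var, evenHeadPoint] at h1 h2 h3
  push_cast at h1 h2 h3
  have hZ : (F.map fun q => hrCoeff Δ ℓ q.1 q.2 / legendreLam ℓ *
      (ArithExpr.mul (.const (1 / 2 ^ q.1))
        (.add (qSumExpr (c 3) L (.mul (.add (.var 0) (.var 1)) (.const (1 / 2))) (-1) (.add (.var 2) (.const q.1)) q.2)
          (qSumExpr (c 4) L (.mul (.add (.var 0) (.var 1)) (.const (1 / 2))) 1 (.add (.var 2) (.const q.1)) q.2))).eval
        (evenHeadPoint ℓ F p.1 p.2 Δ)).sum =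
      evenHeadX (fun ab => (c 3 ab : ℝ)) L.toFinset ℓ F ((p.1 + p.2) / 2) Δ (-1) +
        evenHeadX (fun ab => (c 4 ab : ℝ)) L.toFinset ℓ F ((p.1 + p.2) / 2) Δ 1 := by
    simp only [evenHeadX, ← List.sum_map_add]
    congr 1
    refine List.map_congr_left fun q _ => ?_
    simp only [ArithExpr.eval_mul, ArithExpr.eval_const, ArithExpr.eval_add, ArithExpr.eval_var,
      eval_qSumExpr _ _ hL]
    simp only [evenHeadPoint]
    push_cast
    simp only [one_div, inv_pow]
    ring
  rw [hZ] at h3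
  refine evenHead_nonneg_of_reduced L.toFinset (fun i ab => (c i ab : ℝ)) ℓ F hF hFj hℓΔ p.1 p.2 h1 h2 ?_ a b
  nlinarith [h3]

end Summit.CriticalPhenomena.Ising3D
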